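import Literature.NumberTheory.LFunctions.KMVMomentAsymptoticsUniqueness
import HarnessLib

/-!
# Route `PrimeLevelFamEdge`, crux K_A `MomentsBeyondDiagonal` (stmt-Parity-20007), line «petersson_layers» v4, stub `stub_diag`:
# **normalisation of a per-order target: `Sel_{ij}(q) = K₀·ℓ^{i+j−2} + O(ℓ^{i+j−3})` (`ℓ = log q̂`) gives the order-`(i,j)`
# target of `…DiagOrderSelberg.subDiag_of_selbergOrderAsymptotics` with `τ_{ij} := Δ′²K₀/(2(π²/6)²)`**

Census R3(ii), last step of item 5 of `Cruxes/MomentsBeyondDiagonal/Lines/petersson_layers_stub_diag_g10_blocks.md`. The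
per-order target has the shape `|ℓ⁻¹^{(i+j)}·q̂·Sel_{ij}(q) − 2(π²/6)²·q̂/(Δ′²ℓ²)·τ_{ij}(Δ′,P)| ≤ C·q̂·ℓ⁻¹^3` (`q ≥ q₀`), and
the functional `τ` is FREE except at `(0,0)` (the stub `SubDiag` quantifies `t` existentially). Hence no closed form of the
block constants (`Φ₃/24 − Ψ₁/4 = B₁₁/Δ′²`, …) is needed to close an order: it suffices to know `Sel_{ij}(q)` up to
`O(ℓ^{i+j−3})`, which is what the block calculus (`…DiagDecorShiftedLpow`, `…DecorOrderOneOnePoly`, …) delivers at `M = q̂^{Δ′}`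
(`log M = Δ′ℓ`):

* `orderTarget_of_selbergAsymptotic` — for any sequence `S : ℕ → ℝ`, real `K₀` and `Δ′ ≠ 0`: if
  `|S q − K₀·ℓ^{i+j}/ℓ²| ≤ C·ℓ^{i+j}/ℓ³` for `q ≥ q₀`, then
  `|ℓ⁻¹^{(i+j)}·q̂·S q − 2(π²/6)²·(q̂/(Δ′²ℓ²))·(Δ′²K₀/(2(π²/6)²))| ≤ C·q̂·ℓ⁻¹^3` for `q ≥ max q₀ q₁` (pure bookkeeping;
  `ℓ = log q̂ ≥ 1` eventually by `KMV2000.exists_log_qhat_ge`).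

Def-free; theorems only. Helper `--supports stmt-Parity-20007`; closes nothing; K_A, K_B and the Parity summit are NOT proved;
nothing about Landau–Siegel zeros.

## References
* E. Kowalski, P. Michel, J. VanderKam, J. reine angew. Math. 526 (2000), (23)–(28) pp. 13–15 and Prop. 5.1 p. 18.
  [cite: KowalskiMichelVanderKam2000, (23)–(28) — derivation (normalisation of the diagonal main term)]
-/

noncomputable section

open scoped Real

namespace Summit.Parity.GeneralizedHardyLittlewood.Theorems.MomentsBeyondDiagonal.DiagKernel

open Literature.NumberTheory.LFunctions Literature.NumberTheory.LFunctions.KMV2000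

/-- **Normalisation of a per-order target** (see the module docstring).
[cite: KowalskiMichelVanderKam2000, (23)–(28) — derivation] -/
theorem orderTarget_of_selbergAsymptotic (i j : ℕ) (S : ℕ → ℝ) (K₀ : ℝ) {Δ' : ℝ} (hΔ' : Δ' ≠ 0)
    (h : ∃ C : ℝ, ∃ q₀ : ℕ, ∀ (q : ℕ) [NeZero q], q₀ ≤ q →
      |S q - K₀ * Real.log (qhat q) ^ (i + j) / Real.log (qhat q) ^ 2| ≤
        C * Real.log (qhat q) ^ (i + j) / Real.log (qhat q) ^ 3) :
    ∃ C : ℝ, ∃ q₀ : ℕ, ∀ (q : ℕ) [NeZero q], q₀ ≤ q →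
      |(Real.log (qhat q))⁻¹ ^ (i + j) * qhat q * S q -
          2 * (π ^ 2 / 6) ^ 2 * (qhat q / (Δ' ^ 2 * Real.log (qhat q) ^ 2)) * (Δ' ^ 2 * K₀ / (2 * (π ^ 2 / 6) ^ 2))| ≤
        C * qhat q * (Real.log (qhat q))⁻¹ ^ 3 := by
  obtain ⟨C, q₀, hC⟩ := h
  obtain ⟨q₁, hq₁⟩ := exists_log_qhat_ge (1 : ℝ)
  refine ⟨C, max q₀ q₁, fun q _ hq ↦ ?_⟩
  have hq0 : q₀ ≤ q := le_trans (le_max_left _ _) hq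
  have hq1 : q₁ ≤ q := le_trans (le_max_right _ _) hq
  set ℓ := Real.log (qhat q) with hℓ
  have hℓ1 : 1 ≤ ℓ := hq₁ q hq1
  have hℓ0 : 0 < ℓ := by linarith
  have hQ0 : 0 ≤ qhat q := by unfold qhat; positivity
  have hQ : 0 < qhat q := lt_of_le_of_ne hQ0 fun h0 ↦ by
    have : ℓ = 0 := by rw [hℓ, ← h0, Real.log_zero]
    linarith
  have hπ : (0 : ℝ) < (π ^ 2 / 6) ^ 2 := by positivity
  have h' := hC q hq0
  -- the difference factors as `ℓ⁻¹^{(i+j)}·q̂·(S q − K₀ℓ^{i+j}/ℓ²)`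
  have hfac : ℓ⁻¹ ^ (i + j) * qhat q * S q -
      2 * (π ^ 2 / 6) ^ 2 * (qhat q / (Δ' ^ 2 * ℓ ^ 2)) * (Δ' ^ 2 * K₀ / (2 * (π ^ 2 / 6) ^ 2)) =
      ℓ⁻¹ ^ (i + j) * qhat q * (S q - K₀ * ℓ ^ (i + j) / ℓ ^ 2) := by
    have hℓij : ℓ⁻¹ ^ (i + j) * ℓ ^ (i + j) = 1 := by
      rw [← mul_pow, inv_mul_cancel₀ hℓ0.ne', one_pow]
    have e1 : 2 * (π ^ 2 / 6) ^ 2 * (qhat q / (Δ' ^ 2 * ℓ ^ 2)) * (Δ' ^ 2 * K₀ / (2 * (π ^ 2 / 6) ^ 2)) =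
        qhat q * K₀ / ℓ ^ 2 := by
      field_simp
    have e2 : ℓ⁻¹ ^ (i + j) * qhat q * (S q - K₀ * ℓ ^ (i + j) / ℓ ^ 2) =
        ℓ⁻¹ ^ (i + j) * qhat q * S q - (ℓ⁻¹ ^ (i + j) * ℓ ^ (i + j)) * (qhat q * K₀ / ℓ ^ 2) := by ring
    rw [e1, e2, hℓij, one_mul]
  rw [hfac, abs_mul, abs_mul, abs_of_pos hQ, abs_of_nonneg (by positivity : (0 : ℝ) ≤ ℓ⁻¹ ^ (i + j))]
  calc ℓ⁻¹ ^ (i + j) * qhat q * |S q - K₀ * ℓ ^ (i + j) / ℓ ^ 2|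
      ≤ ℓ⁻¹ ^ (i + j) * qhat q * (C * ℓ ^ (i + j) / ℓ ^ 3) :=
        mul_le_mul_of_nonneg_left h' (by positivity)
    _ = C * qhat q * ℓ⁻¹ ^ 3 * (ℓ⁻¹ ^ (i + j) * ℓ ^ (i + j)) := by
        field_simp
    _ = C * qhat q * ℓ⁻¹ ^ 3 := by
        rw [← mul_pow, inv_mul_cancel₀ hℓ0.ne', one_pow, mul_one]

end Summit.Parity.GeneralizedHardyLittlewood.Theorems.MomentsBeyondDiagonal.DiagKernel

end
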